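import Summits.Ventures.Crystal3D.Theorems.StickyWulffConstantTextureBuildCellFlip
import HarnessLib

/-!
# TB-D assembly, part 14: LABELLED CELLS — a labelling of arrangement cells IS a piece family (PieceData's structural fields for free)
# (lane T, crux `TextureLiminfV5`, stmt-Ventures-23912; blueprint HOME/wulff-p2/g20/TB-D-2-g20.md §1 (1b)–(1d); ruling (ccxi)(D))

HONEST FRAMING. Venture `Summits/Ventures/Crystal3D` (cell `crystal3d-full`), route `route-Ventures-StickyWulffConstant`, helper `--supports` the
law-v5 crux `TextureLiminfV5` (stmt-Ventures-23912).  One DEFINITION (a structure) + its derived piece family and the two flip lemmas in piece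
language (census-free, standard axioms).  Mesh-agnostic: the plane set `𝓗` and the labels are data; the mesh-specific vocabulary ('…TextureBuildCells')
instantiates it.  F-C1 not moved.

* `LabelledCells` — an arrangement `𝓗` (unit normals), finitely many NONEMPTY BOUNDED cells given by pairwise distinct positive parts `T j ⊆ 𝓗`, and a
  label `lab j : Option (Fin n)` (class of the cell, or void);
* the PIECE FAMILY of the labelled cells: `M`, `Hp`, `cls` with `hbd`, `hunit`, `hplanes` (distinct facet planes on a nonempty cell), `hdisj` (distinct
  positive parts ⇒ disjoint cells) — exactly `PieceData`'s structural fields;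
* `facetArea_exposed_eq_zero_of_labelled_flip` — if the flip of piece `i` across its facet `q` is a LABELLED cell, the exposed part of that facet is null;
* `exists_labelled_flip_of_ae_subset` — if at a generic facet point some far half-ball is a.e. inside the union of the PIECES, the flip is a labelled
  cell, and it is another piece `i' ≠ i` (the engine of the (P1)/(P2) rows: «material across ⇒ covered / a genuine contact pair»).
-/

noncomputable section

namespace Summit.Ventures.Crystal3D.Cruxes.TextureLiminf.TexShadow

open Summit.Ventures.Crystal3D Summit.Ventures.Crystal3D.Theorems MeasureTheory Set
open scoped InnerProductSpace

/-- **LABELLED CELLS**: an arrangement, finitely many nonempty bounded cells with pairwise distinct positive parts, and a class label per cell. -/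
structure LabelledCells where
  /-- the arrangement (unit normals) -/
  𝓗 : Finset (E3 × ℝ)
  h1 : ∀ p ∈ 𝓗, ‖p.1‖ = 1
  /-- the cells, by their positive parts -/
  k : ℕ
  T : Fin k → Finset (E3 × ℝ)
  hT : ∀ j, T j ⊆ 𝓗
  hne : ∀ j, (polytope (signedH 𝓗 (T j))).Nonempty
  hbd : ∀ j, Bornology.IsBounded (polytope (signedH 𝓗 (T j)))
  hinj : Function.Injective T
  /-- number of classes and the labels (`none` = void) -/
  n : ℕ
  lab : Fin k → Option (Fin n)

namespace LabelledCells

variable (L : LabelledCells)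

/-- the cell `j` -/
def cell (j : Fin L.k) : Set E3 := polytope (signedH L.𝓗 (L.T j))

/-- the labelled cell indices (a finite subtype) -/
abbrev Idx : Type := {j : Fin L.k // (L.lab j).isSome = true}

/-- number of pieces -/
def M : ℕ := Fintype.card L.Idx

/-- enumeration of the labelled cells -/
def idx (i : Fin L.M) : Fin L.k := ((Fintype.equivFin L.Idx).symm i).1

/-- The enumerated cells are labelled. -/
theorem isSome_lab_idx (i : Fin L.M) : (L.lab (L.idx i)).isSome = true := ((Fintype.equivFin L.Idx).symm i).2

/-- `idx` is injective. -/
theorem idx_injective : Function.Injective L.idx := by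
  intro i i' h
  have : (Fintype.equivFin L.Idx).symm i = (Fintype.equivFin L.Idx).symm i' := Subtype.ext h
  exact (Fintype.equivFin L.Idx).symm.injective this

/-- Every labelled cell is enumerated. -/
theorem exists_idx_eq {j : Fin L.k} (hj : (L.lab j).isSome = true) : ∃ i : Fin L.M, L.idx i = j :=
  ⟨Fintype.equivFin L.Idx ⟨j, hj⟩, by simp [idx]⟩

/-- the `H`-representation of piece `i` -/
def Hp (i : Fin L.M) : Finset (E3 × ℝ) := signedH L.𝓗 (L.T (L.idx i))

/-- the class of piece `i` -/
def cls (i : Fin L.M) : Fin L.n := (L.lab (L.idx i)).get (L.isSome_lab_idx i)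

/-- The class is the label. -/
theorem lab_idx (i : Fin L.M) : L.lab (L.idx i) = some (L.cls i) := by
  simp [cls]

/-- Pieces are bounded. -/
theorem hbd_Hp (i : Fin L.M) : Bornology.IsBounded (polytope (L.Hp i)) := L.hbd _

/-- Pieces have unit normals. -/
theorem hunit_Hp (i : Fin L.M) : ∀ p ∈ L.Hp i, ‖p.1‖ = 1 := fun _ hp => norm_fst_of_mem_signedH L.h1 hp

/-- On a nonempty cell, distinct signed data carry distinct planes. -/
theorem planes_ne_of_nonempty {𝓗 T : Finset (E3 × ℝ)} (h1 : ∀ p ∈ 𝓗, ‖p.1‖ = 1) (hne : (polytope (signedH 𝓗 T)).Nonempty)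
    {q q' : E3 × ℝ} (hq : q ∈ signedH 𝓗 T) (hq' : q' ∈ signedH 𝓗 T) (hqq' : q ≠ q') :
    {x : E3 | ⟪q.1, x⟫_ℝ = q.2} ≠ {x : E3 | ⟪q'.1, x⟫_ℝ = q'.2} := by
  intro heq
  have hn := norm_fst_of_mem_signedH h1 hq
  have hn' := norm_fst_of_mem_signedH h1 hq'
  rcases eq_or_eq_neg_of_setOf_inner_eq hn hn' heq with ⟨ha, hb⟩ | ⟨ha, hb⟩
  · exact hqq' (Prod.ext ha.symm hb.symm)
  · obtain ⟨x, hx⟩ := hne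
    have hx' := hx
    simp only [polytope, mem_iInter, mem_setOf_eq] at hx'
    have h₁ : ⟪q.1, x⟫_ℝ < q.2 := hx' q hq
    have h₂ : ⟪q'.1, x⟫_ℝ < q'.2 := hx' q' hq'
    rw [ha, hb, inner_neg_left] at h₂
    linarith

/-- Pieces have pairwise distinct facet planes. -/
theorem hplanes_Hp (i : Fin L.M) : ∀ p ∈ L.Hp i, ∀ p' ∈ L.Hp i, p ≠ p' →
    {x : E3 | ⟪p.1, x⟫_ℝ = p.2} ≠ {x : E3 | ⟪p'.1, x⟫_ℝ = p'.2} :=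
  fun _ hp _ hp' hne => planes_ne_of_nonempty L.h1 (L.hne _) hp hp' hne

/-- Cells with different positive parts are disjoint. -/
theorem disjoint_cell {j j' : Fin L.k} (hjj' : j ≠ j') : Disjoint (L.cell j) (L.cell j') := by
  have hne : L.T j ≠ L.T j' := fun h => hjj' (L.hinj h)
  obtain ⟨p, hp⟩ : ∃ p, ¬ (p ∈ L.T j ↔ p ∈ L.T j') := by
    by_contra h
    push Not at h
    exact hne (Finset.ext h)
  by_cases hpj : p ∈ L.T j
  · have hpj' : p ∉ L.T j' := fun h' => hp ⟨fun _ => h', fun _ => hpj⟩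
    exact disjoint_polytope_signedH L.𝓗 _ _ (L.hT j hpj) hpj hpj'
  · have hpj' : p ∈ L.T j' := by
      by_contra h'
      exact hp ⟨fun h => absurd h hpj, fun h => absurd h h'⟩
    exact (disjoint_polytope_signedH L.𝓗 _ _ (L.hT j' hpj') hpj' hpj).symm

/-- Pieces are pairwise disjoint. -/
theorem hdisj_Hp (i i' : Fin L.M) (hii' : i ≠ i') : Disjoint (polytope (L.Hp i)) (polytope (L.Hp i')) :=
  L.disjoint_cell fun h => hii' (L.idx_injective h)

/-! ### Flips in piece language -/

/-- A flip changes the positive part (at the datum of `𝓗` on the facet's plane). -/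
theorem flipT_ne {𝓗 T : Finset (E3 × ℝ)} {q : E3 × ℝ} (hq : q ∈ signedH 𝓗 T) {T' : Finset (E3 × ℝ)}
    (h : signedH 𝓗 T' = signedH 𝓗 (flipT 𝓗 T q)) (hne : (polytope (signedH 𝓗 T)).Nonempty) : polytope (signedH 𝓗 T') ≠ polytope (signedH 𝓗 T) := by
  obtain ⟨p₀, hp₀, h₀⟩ := exists_mem_of_mem_signedH hq
  intro hEq
  -- `p₀`'s side differs between `T` and `flipT`, so the two cells are disjoint; but they are equal and nonempty
  have hdisj : Disjoint (polytope (signedH 𝓗 (flipT 𝓗 T q))) (polytope (signedH 𝓗 T)) := by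
    rcases h₀ with ⟨hpT, hpq⟩ | ⟨hpT, hpq⟩
    · have hnot : p₀ ∉ flipT 𝓗 T q := fun hf => ((mem_flipT_of_eq hp₀ (Or.inl hpq)).1 hf) hpT
      exact (disjoint_polytope_signedH 𝓗 T _ hp₀ hpT hnot).symm
    · have hmem : p₀ ∈ flipT 𝓗 T q := (mem_flipT_of_eq hp₀ (Or.inr hpq)).2 hpT
      exact disjoint_polytope_signedH 𝓗 _ T hp₀ hmem hpT
  rw [← h, hEq] at hdisj
  obtain ⟨x, hx⟩ := hne
  exact Set.disjoint_left.1 hdisj hx hx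

/-- **A labelled flip covers the facet**: if the cell across the facet `q` of piece `i` is a labelled cell, the exposed part of the facet is null. -/
theorem facetArea_exposed_eq_zero_of_labelled_flip (i : Fin L.M) {q : E3 × ℝ} (hq : q ∈ L.Hp i)
    {j' : Fin L.k} (hj' : (L.lab j').isSome = true) (hflip : signedH L.𝓗 (L.T j') = signedH L.𝓗 (flipT L.𝓗 (L.T (L.idx i)) q)) :
    facetArea ((closure (polytope (L.Hp i)) ∩ {x : E3 | ⟪q.1, x⟫_ℝ = q.2}) \
      ⋃ i' ∈ Finset.univ.erase i, closure (polytope (L.Hp i'))) q.1 = 0 := by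
  classical
  obtain ⟨i', hi'⟩ := L.exists_idx_eq hj'
  have hne : i' ≠ i := by
    intro h
    have hcell : polytope (signedH L.𝓗 (L.T j')) ≠ polytope (signedH L.𝓗 (L.T (L.idx i))) := flipT_ne hq hflip (L.hne _)
    apply hcell
    rw [← hi', h]
  refine facetArea_exposed_eq_zero_of_flip L.Hp L.h1 (i₀ := i) rfl (L.hbd _) hq hne ?_
  show polytope (L.Hp i') = polytope (signedH L.𝓗 (flipT L.𝓗 (L.T (L.idx i)) q))
  unfold Hp; rw [hi', hflip]

/-- **Material across ⇒ the flip is another piece**: at a generic point of the facet `q` of piece `i`, if some far half-ball is a.e. inside the union of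
the pieces, then some piece `i' ≠ i` IS the flipped cell. -/
theorem exists_labelled_flip_of_ae_subset (i : Fin L.M) {q : E3 × ℝ} (hq : q ∈ L.Hp i) {y : E3} (hyq : ⟪q.1, y⟫_ℝ = q.2)
    (hy : y ∈ closure (polytope (L.Hp i))) (hgen : ∀ p ∈ L.𝓗, ¬ (p = q ∨ p = antip q) → ⟪p.1, y⟫_ℝ ≠ p.2)
    {ρ : ℝ} (hρ : 0 < ρ) (hae : volume ((Metric.ball y ρ ∩ {x : E3 | q.2 < ⟪q.1, x⟫_ℝ}) \ ⋃ i' : Fin L.M, polytope (L.Hp i')) = 0) :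
    ∃ i' : Fin L.M, i' ≠ i ∧ polytope (L.Hp i') = polytope (signedH L.𝓗 (flipT L.𝓗 (L.T (L.idx i)) q)) := by
  classical
  have hae' : volume ((Metric.ball y ρ ∩ {x : E3 | q.2 < ⟪q.1, x⟫_ℝ}) \
      ⋃ i' ∈ (Finset.univ : Finset (Fin L.M)), polytope (signedH L.𝓗 (L.T (L.idx i')))) = 0 := by
    have : (⋃ i' ∈ (Finset.univ : Finset (Fin L.M)), polytope (signedH L.𝓗 (L.T (L.idx i')))) = ⋃ i' : Fin L.M, polytope (L.Hp i') := by
      ext x; simp [Hp]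
    rw [this]; exact hae
  obtain ⟨i', -, hi'⟩ := flip_mem_of_ae_subset (Finset.univ : Finset (Fin L.M)) (fun i' => L.T (L.idx i')) hq
    (norm_fst_of_mem_signedH L.h1 hq) hyq hy hgen hρ hae'
  refine ⟨i', fun h => ?_, by unfold Hp; rw [hi']⟩
  have hcell := flipT_ne hq hi' (L.hne _)
  exact hcell (by rw [h])

end LabelledCells

end Summit.Ventures.Crystal3D.Cruxes.TextureLiminf.TexShadow

end
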